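import Summits.QuantumFields.YangMills.Theorems.LangevinControlUVOSLegsFromFemtoAndGapDefs
import HarnessLib

/-!
# Crux `NT` (stmt-QuantumFields-19353), stub `stub_cfp : CFP`: exact dilation covariance of the conditional femto package

Helper file (`--supports stmt-QuantumFields-19353`) of the fleet lead prover of crux `NT` (unit `ym-spine-19353-p1`,
g2).  The registered stub `stub_cfp : CFP` (skeleton v2 «conditional-package», b5b471720c374849) asks for a unit map `a`
carrying `FBL G r a ∧ FC2 G r a ∧ FC3 G r a` (`Theorems/LangevinControlUVOSLegsFromFemtoAndGapDefs.lean` :136/:150/:161).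
The three clauses see the unit map only through the femto conditions `b · a β ≤ ℓ`, the physical separations
`‖y − x‖ · a β` fed to the shape functions `Γ`, `Γ₃` and the collars `K`, `K₃`, and the scale thresholds `s₀ ≤ ν · a β`;
all of these are EXACTLY covariant under `a ↦ κ · a` for a constant `κ > 0` (rescale `ℓ`, precompose `Γ`, `K` with
`s ↦ s/κ`).  Hence the unit of the package is determined only up to a positive constant — the companion of the seam's
`UnitDilation` file (crux `UVSeamRec`, stmt-QuantumFields-20043), which proves the same for `LowerBounds`, `MomentBounds6`,
`GapInUnits`:

* `fbl_of_le_const_mul` — `FBL` even transfers along `a β ≤ κ · a' β` (eventually): a boundary law in finer-or-comparable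
  units gives the boundary law in coarser units; `fbl_const_mul_iff`;
* `fc2_const_mul`, `fc2_const_mul_iff`; `fc3_const_mul`, `fc3_const_mul_iff`;
* `cfpBody_const_mul_iff` — the body of `CFP` at `(r, κ · a)` iff at `(r, a)`.
-/

set_option autoImplicit false

noncomputable section

open MeasureTheory Filter Topology
open Literature.MathematicalPhysics.QuantumFieldTheory Literature.MathematicalPhysics.QuantumLattice
open Literature.Probability.LatticeModels
open Summit.QuantumFields.YangMills.Cruxes.OSLegsFromFemtoAndGap.DlrCollarTransfer

namespace Summit.QuantumFields.YangMills.Cruxes.NT.ConditionalPackage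

/-! ## §1 Rescaling the scale variable -/

/-- `s ↦ s / κ` maps `0⁺` to `0⁺` for `κ > 0`. [folklore] -/
theorem tendsto_div_const_nhdsGT_zero {κ : ℝ} (hκ : 0 < κ) :
    Tendsto (fun s : ℝ => s / κ) (nhdsWithin 0 (Set.Ioi 0)) (nhdsWithin 0 (Set.Ioi 0)) := by
  refine tendsto_nhdsWithin_iff.2 ⟨?_, ?_⟩
  · have h : Tendsto (fun s : ℝ => s / κ) (𝓝 0) (𝓝 (0 / κ)) := tendsto_id.div_const κ
    rw [zero_div] at h
    exact h.mono_left nhdsWithin_le_nhds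
  · filter_upwards [self_mem_nhdsWithin] with s hs
    exact div_pos hs hκ

/-- A collar growth clause `s K(s) → 0` is invariant under precomposition with `s ↦ s/κ`. [folklore] -/
theorem tendsto_mul_comp_div {K : ℝ → ℝ} {κ : ℝ} (hκ : 0 < κ)
    (h : Tendsto (fun s : ℝ => s * K s) (nhdsWithin 0 (Set.Ioi 0)) (nhds 0)) :
    Tendsto (fun s : ℝ => s * K (s / κ)) (nhdsWithin 0 (Set.Ioi 0)) (nhds 0) := by
  have h1 := (h.comp (tendsto_div_const_nhdsGT_zero hκ)).const_mul κ
  rw [mul_zero] at h1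
  refine h1.congr fun s => ?_
  simp only [Function.comp_apply]
  field_simp

/-- A shape growth clause `Γ(s)/s^k → ∞` is invariant under precomposition with `s ↦ s/κ`. [folklore] -/
theorem tendsto_div_pow_comp_div {Γ : ℝ → ℝ} {κ : ℝ} (hκ : 0 < κ) (k : ℕ)
    (h : Tendsto (fun s : ℝ => Γ s / s ^ k) (nhdsWithin 0 (Set.Ioi 0)) atTop) :
    Tendsto (fun s : ℝ => Γ (s / κ) / s ^ k) (nhdsWithin 0 (Set.Ioi 0)) atTop := by
  have h1 := (h.comp (tendsto_div_const_nhdsGT_zero hκ)).atTop_mul_const (inv_pos.2 (pow_pos hκ k))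
  refine h1.congr fun s => ?_
  simp only [Function.comp_apply]
  rw [div_pow]
  field_simp

/-- Continuity on `(0, κ ℓ]` of `Γ ∘ (·/κ)` from continuity of `Γ` on `(0, ℓ]`. [folklore] -/
theorem continuousOn_comp_div {Γ : ℝ → ℝ} {κ ℓ : ℝ} (hκ : 0 < κ) (h : ContinuousOn Γ (Set.Ioc 0 ℓ)) :
    ContinuousOn (fun s => Γ (s / κ)) (Set.Ioc 0 (κ * ℓ)) := by
  refine h.comp (continuousOn_id.div_const κ) fun s hs => ?_
  obtain ⟨hs0, hsℓ⟩ := hs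
  exact ⟨div_pos hs0 hκ, by rw [div_le_iff₀ hκ, mul_comm]; exact hsℓ⟩

/-! ## §2 The boundary law -/

section Lattice

variable (G : Type) [Group G] [TopologicalSpace G] [IsTopologicalGroup G] [CompactSpace G]
  [MeasurableSpace G] [BorelSpace G] (r : LatticeRep G)

/-- **`FBL` transfers to coarser-or-comparable units.**  If `a β ≤ κ · a' β` for `β ≥ β₀` (`κ > 0`), then the femto
boundary law in units `a` gives the femto boundary law in units `a'` (a femto cube for `a'` with range `ℓ₁/κ` is a
femto cube for `a` with range `ℓ₁`). [folklore] -/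
theorem fbl_of_le_const_mul {a a' : ℝ → ℝ} {κ β₀ : ℝ} (hκ : 0 < κ) (hle : ∀ β, β₀ ≤ β → a β ≤ κ * a' β)
    (h : FBL G r a) : FBL G r a' := by
  obtain ⟨C₁, β₁, ℓ₁, p, hℓ₁, hC₁, H⟩ := h
  refine ⟨C₁, max β₁ β₀, ℓ₁ / κ, p, div_pos hℓ₁ hκ, hC₁, ?_⟩
  intro β hβ c b hb η x hx
  refine H β (le_of_max_le_left hβ) c b ?_ η x hx
  have h1 : (b : ℝ) * a β ≤ (b : ℝ) * (κ * a' β) :=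
    mul_le_mul_of_nonneg_left (hle β (le_of_max_le_right hβ)) (Nat.cast_nonneg b)
  have h2 : (b : ℝ) * (κ * a' β) = κ * ((b : ℝ) * a' β) := by ring
  rw [le_div_iff₀ hκ] at hb
  linarith

/-- **`FBL` is exactly dilation covariant**: `FBL G r (κ · a) ↔ FBL G r a` for `κ > 0`. [folklore] -/
theorem fbl_const_mul_iff (a : ℝ → ℝ) {κ : ℝ} (hκ : 0 < κ) : FBL G r (fun β => κ * a β) ↔ FBL G r a := by
  constructor
  · exact fbl_of_le_const_mul G r (β₀ := 0) hκ fun β _ => le_rfl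
  · exact fbl_of_le_const_mul G r (β₀ := 0) (inv_pos.2 hκ) fun β _ =>
      le_of_eq (by rw [← mul_assoc, inv_mul_cancel₀ hκ.ne', one_mul])

/-! ## §3 The conditional two-point and three-point clauses -/

/-- **`FC2` is dilation covariant**: `FC2 G r a → FC2 G r (κ · a)` for `κ > 0` (range `κ ℓ₂`, shape `Γ(·/κ)`,
collar `K(·/κ)`, same constants). [folklore] -/
theorem fc2_const_mul (a : ℝ → ℝ) {κ : ℝ} (hκ : 0 < κ) (h : FC2 G r a) : FC2 G r (fun β => κ * a β) := by
  obtain ⟨Γ, β₂, ℓ₂, c₂, C₂, K, n₀, hℓ₂, hc₂, hK1, hKlim, hn₀, hΓc, hΓ, hΓlim, H⟩ := h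
  refine ⟨fun s => Γ (s / κ), β₂, κ * ℓ₂, c₂, C₂, fun s => K (s / κ), n₀, mul_pos hκ hℓ₂, hc₂,
    fun s => hK1 _, tendsto_mul_comp_div hκ hKlim, hn₀, continuousOn_comp_div hκ hΓc, ?_,
    tendsto_div_pow_comp_div hκ 8 hΓlim, ?_⟩
  · intro s hs hsℓ
    exact hΓ _ (div_pos hs hκ) (by rw [div_le_iff₀ hκ, mul_comm]; exact hsℓ)
  · intro β hβ c b hb η x y s₀ hs₀ hs₀le hn hKx hKy
    have hb' : (b : ℝ) * a β ≤ ℓ₂ := by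
      have : (b : ℝ) * (κ * a β) = κ * ((b : ℝ) * a β) := by ring
      rw [this] at hb
      exact le_of_mul_le_mul_left hb hκ
    have hs₀' : s₀ / κ ≤ ‖siteToE (y - x)‖ * a β := by
      rw [div_le_iff₀ hκ]
      calc s₀ ≤ ‖siteToE (y - x)‖ * (κ * a β) := hs₀le
        _ = ‖siteToE (y - x)‖ * a β * κ := by ring
    have key := H β hβ c b hb' η x y (s₀ / κ) (div_pos hs₀ hκ) hs₀' hn hKx hKy
    have e : ‖siteToE (y - x)‖ * (κ * a β) / κ = ‖siteToE (y - x)‖ * a β := by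
      field_simp
    simp only [e]
    exact key

/-- `FC2 G r (κ · a) ↔ FC2 G r a` for `κ > 0`. [folklore] -/
theorem fc2_const_mul_iff (a : ℝ → ℝ) {κ : ℝ} (hκ : 0 < κ) : FC2 G r (fun β => κ * a β) ↔ FC2 G r a := by
  refine ⟨fun h => ?_, fc2_const_mul G r a hκ⟩
  have h' := fc2_const_mul G r (fun β => κ * a β) (inv_pos.2 hκ) h
  have e : (fun β => κ⁻¹ * (κ * a β)) = a := by
    funext β; rw [← mul_assoc, inv_mul_cancel₀ hκ.ne', one_mul]
  rwa [e] at h'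

/-- **`FC3` is dilation covariant**: `FC3 G r a → FC3 G r (κ · a)` for `κ > 0` (range `κ ℓ₃`, shape `Γ₃(·/κ)`,
collar `K₃(·/κ)`, same reference triangle, sign and constants). [folklore] -/
theorem fc3_const_mul (a : ℝ → ℝ) {κ : ℝ} (hκ : 0 < κ) (h : FC3 G r a) : FC3 G r (fun β => κ * a β) := by
  obtain ⟨v, w, σ, δ, Γ₃, β₃, ℓ₃, c₃, K₃, n₃, hσ, hδ, hv, hw, hvw, hℓ₃, hc₃, hK1, hKlim, hn₃, hΓc, hΓ, hΓlim, H⟩ :=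
    h
  refine ⟨v, w, σ, δ, fun s => Γ₃ (s / κ), β₃, κ * ℓ₃, c₃, fun s => K₃ (s / κ), n₃, hσ, hδ, hv, hw, hvw,
    mul_pos hκ hℓ₃, hc₃, fun s => hK1 _, tendsto_mul_comp_div hκ hKlim, hn₃, continuousOn_comp_div hκ hΓc, ?_,
    tendsto_div_pow_comp_div hκ 4 hΓlim, ?_⟩
  · intro s hs hsℓ
    exact hΓ _ (div_pos hs hκ) (by rw [div_le_iff₀ hκ, mul_comm]; exact hsℓ)
  · intro β hβ c b hb η n x y z s₀ hs₀ hs₀le hn hy hz hKx hKy hKz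
    have hb' : (b : ℝ) * a β ≤ ℓ₃ := by
      have : (b : ℝ) * (κ * a β) = κ * ((b : ℝ) * a β) := by ring
      rw [this] at hb
      exact le_of_mul_le_mul_left hb hκ
    have hs₀' : s₀ / κ ≤ (n : ℝ) * a β := by
      rw [div_le_iff₀ hκ]
      calc s₀ ≤ (n : ℝ) * (κ * a β) := hs₀le
        _ = (n : ℝ) * a β * κ := by ring
    have key := H β hβ c b hb' η n x y z (s₀ / κ) (div_pos hs₀ hκ) hs₀' hn hy hz hKx hKy hKz
    have e : (n : ℝ) * (κ * a β) / κ = (n : ℝ) * a β := by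
      field_simp
    simp only [e]
    exact key

/-- `FC3 G r (κ · a) ↔ FC3 G r a` for `κ > 0`. [folklore] -/
theorem fc3_const_mul_iff (a : ℝ → ℝ) {κ : ℝ} (hκ : 0 < κ) : FC3 G r (fun β => κ * a β) ↔ FC3 G r a := by
  refine ⟨fun h => ?_, fc3_const_mul G r a hκ⟩
  have h' := fc3_const_mul G r (fun β => κ * a β) (inv_pos.2 hκ) h
  have e : (fun β => κ⁻¹ * (κ * a β)) = a := by
    funext β; rw [← mul_assoc, inv_mul_cancel₀ hκ.ne', one_mul]
  rwa [e] at h'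

/-! ## §4 The body of `CFP` -/

/-- **The body of `CFP` is exactly dilation covariant**: for `κ > 0`, the unit map `κ · a` carries
`(0 < ·) ∧ (· → 0) ∧ FBL ∧ FC2 ∧ FC3` iff `a` does — the registered stub determines the unit only up to a positive
constant (companion of `UVSeamRec.UnitDilation.lowerBounds_const_mul_iff` for the crux's conclusion). [folklore] -/
theorem cfpBody_const_mul_iff (a : ℝ → ℝ) {κ : ℝ} (hκ : 0 < κ) :
    ((∀ β, 0 < κ * a β) ∧ Tendsto (fun β => κ * a β) atTop (𝓝 0) ∧ FBL G r (fun β => κ * a β) ∧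
        FC2 G r (fun β => κ * a β) ∧ FC3 G r (fun β => κ * a β)) ↔
      ((∀ β, 0 < a β) ∧ Tendsto a atTop (𝓝 0) ∧ FBL G r a ∧ FC2 G r a ∧ FC3 G r a) := by
  have hpos : (∀ β, 0 < κ * a β) ↔ (∀ β, 0 < a β) :=
    ⟨fun h β => pos_of_mul_pos_right (h β) hκ.le, fun h β => mul_pos hκ (h β)⟩
  have hlim : Tendsto (fun β => κ * a β) atTop (𝓝 0) ↔ Tendsto a atTop (𝓝 0) := by
    constructor
    · intro h
      have h' := h.const_mul κ⁻¹
      rw [mul_zero] at h'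
      refine h'.congr fun β => ?_
      rw [← mul_assoc, inv_mul_cancel₀ hκ.ne', one_mul]
    · intro h
      have h' := h.const_mul κ
      rwa [mul_zero] at h'
  rw [hpos, hlim, fbl_const_mul_iff G r a hκ, fc2_const_mul_iff G r a hκ, fc3_const_mul_iff G r a hκ]

end Lattice

end Summit.QuantumFields.YangMills.Cruxes.NT.ConditionalPackage

end
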